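import Summits.BirchSwinnertonDyer.BirchSwinnertonDyer.Theorems.AlignedTransportAtTwoMainConjectureOfRankZeroBSDAtTwoEisensteinRigidityRoad
import Summits.BirchSwinnertonDyer.Rank1Residual.Iwasawa.RankGrowthCyclotomicFactor
import HarnessLib

/-!
# Route `AlignedTransportAtTwo`, crux C2 `MainConjectureOfRankZeroBSDAtTwo` (stmt-BirchSwinnertonDyer-22298):
# KATO'S RANK BOUND AT THE SECOND FIXED POINT — `rank W(ℚ₁) ≤ rank W(ℚ) + ord_{T=−2} L₂(W,T)` at the first layer `ℚ₁ = ℚ(√2)` of the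
# cyclotomic `ℤ₂`-tower; on the `a₂ = +1` road `rank W(ℚ(√2)) ≤ 1`, on the `a₂ = −1` road `≤ 3`

HONEST FRAMING (cell `bsd-f1-sign2`, WIDTH-5 attached prover seat `bsd-line-att-p5` gen 34 on line `birth` of the lead
`bsd-line-att-p2`; `--supports` stmt-BirchSwinnertonDyer-22298, closes nothing; BSD is NOT proved by any of this; the crux C2, its
verdict «blocked-on `Rank1Residual.GreenbergMuConjectureIrreducible`» and every registered stub are untouched). THEOREMS ONLY — no
`def`, no `sorry`, nothing asserted. The one PRINT binder is `h17` = Kato 2004 Thm. 17.4 (1)(2) AT `2` (`kato_divisibility_allPrimes W 2`),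
exactly as in the lead's file; §3 adds `hGZK` (Gross–Zagier–Kolyvagin) to read `rank W(ℚ) = 0` from `r_an = 0`.

THE POINT. At `p = 2` the second fixed point `T = −2` of the `Λ`-adic involution IS the character of order `2` of `Γ`, i.e. the first layer
`ℚ₁ = ℚ(√2)` of `ℚ_∞` (tree: `IsCyclotomic.exists_sq_eq_two_layer_one`), and the tree's `ξ₂ = Φ₂(1+T)` IS `T + 2` (§1 `xi_two`). Greenberg's
p. 132 count (tree THEOREM `xi_pow_dvd_of_charIdeal_eq_span_of_rank_le`: `rank E(K) + (p−1)t ≤ rank E(K₁) ⇒ ξ_p^t ∣ f_X`) and Kato's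
divisibility pulled back to `Λ` (this seat's `isTorsion_and_exists_charGen_mul_eq_C_pow_mul_of_kato`: `f_X · a = 2ⁿ · G`, `ι G = L₂(f,α)`)
give, since `T+2` is prime and does not divide `2ⁿ`:

* §2 ★ `mordellWeilRank_layer_one_le_add_orderAtNegTwo` — **`rank W(ℚ₁) ≤ rank W(ℚ) + ord_{T=−2} G`** for EVERY `W/ℚ` good ordinary at `2` and
  every integral lift `G` of its `2`-adic `L`-function (any newform level): Kato's «`rank ≤ ord_{s=1} L_p`» at the order-`2` character, i.e. for the
  Mordell–Weil growth in `ℚ(√2)/ℚ` (the quadratic twist by `ℚ(√2)`). `not_layerRankGEAt_one` — the typed certificate `Iwasawa.LayerRankGEAt W 2 1 m`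
  is REFUTED for `m > rank W(ℚ) + ord₋₂ G`.
* §3 on this seat's road (`Δ_min ≡ 3,5 (8)`, `∏ c_v` odd, `r_an = 0`, `‖[0]⁺_f‖₂ = 1`; g33: `ord₋₂ L₂ = 1` for `a₂ = +1`, `∈ {1,3}` for `a₂ = −1`):
  ★ `mordellWeilRank_layer_one_le_one_of_road` — **`a₂ = +1 ⇒ rank W(ℚ(√2)) ≤ 1`**; `mordellWeilRank_layer_one_le_three_of_road` — **`a₂ = −1 ⇒ ≤ 3`**;
  road-free `mordellWeilRank_layer_one_le_two_of_frobeniusTrace_eq_one` (`a₂ = +1`, good ordinary, `‖[0]⁺_f‖₂ = 1`: `≤ 2`, no `μ`, no road) and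
  `…_le_four_of_frobeniusTrace_eq_neg_one`. With `w(W ⊗ χ₈) = −1` on the road (g32/g33) the parity conjecture predicts `rank W(ℚ(√2))` odd, so `= 1` on
  the `a₂ = +1` half — the Eisenstein rigidity file's «no Mordell–Weil explanation of `λ₂ − 1`» made quantitative at the first layer.

References: K. Kato, Astérisque 295 (2004), Thm. 17.4, Thm. 18.4 [Kato2004Asterisque]; R. Greenberg, LNM 1716 (1999), Thm. 1.9, §5 p. 132, p. 176
(conductor 69: «`E(ℚ(√2))` has rank 1. But `ℚ(√2)` is the first layer in the cyclotomic `ℤ₂`-extension») [GreenbergLNM1716]; B. Mazur, J. Tate,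
J. Teitelbaum, Invent. Math. 84 (1986) §I.14 [MazurTateTeitelbaum1986Invent].
-/

set_option linter.dupNamespace false
set_option autoImplicit false

noncomputable section

open scoped Classical MatrixGroups ModularForm

namespace Summit.BirchSwinnertonDyer.BirchSwinnertonDyer.Theorems.AlignedTransportAtTwoLayerOneRankBound

open PowerSeries CongruenceSubgroup WeierstrassCurve Literature.NumberTheory.EllipticCurves
  Literature.NumberTheory.EllipticCurves.ModularForms
  Literature.NumberTheory.EllipticCurves.Rank1Residual
  Literature.NumberTheory.EllipticCurves.Greenberg1999
  Summit.BirchSwinnertonDyer.Rank1Residual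
  Summit.BirchSwinnertonDyer.Rank1Residual.X1.MuLambda
  Summit.BirchSwinnertonDyer.Rank1Residual.X1.CyclotomicZeros
  Summit.BirchSwinnertonDyer.Rank1Residual.F1Sign2
  Summit.BirchSwinnertonDyer.Rank1Residual.Iwasawa
  Summit.BirchSwinnertonDyer.BirchSwinnertonDyer.Theorems.AlignedTransportAtTwoTwoFixedPoints
  Summit.BirchSwinnertonDyer.BirchSwinnertonDyer.Theorems.AlignedTransportAtTwoRoadSecondFixedPoint
  Summit.BirchSwinnertonDyer.BirchSwinnertonDyer.Theorems.AlignedTransportAtTwoEisensteinRigidityRoad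

/-! ## §1 `ξ₂ = T + 2`: at `p = 2` the cyclotomic factor of the first layer is the linear factor of the second fixed point -/

/-- **`ξ₂ = Φ₂(1+T) = T + 2`** in `Λ = ℤ₂⟦T⟧` (`ξ₂·T = (1+T)² − 1 = T² + 2T`, cancel `T`). [folklore] -/
theorem xi_two : (xi 2 : IwasawaAlgebra 2) = X + C (2 : ℤ_[2]) := by
  have h := xi_mul_X (p := 2)
  have h2 : ((X + C (2 : ℤ_[2])) * X : PowerSeries ℤ_[2]) = (1 + X) ^ 2 - 1 := by
    rw [map_ofNat]; ring
  exact mul_right_cancel₀ X_ne_zero (h.trans h2.symm)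

/-! ## §2 Kato's rank bound at the order-2 character: `rank W(ℚ₁) ≤ rank W(ℚ) + ord_{T=−2} G` -/

variable (W : WeierstrassCurve ℚ) [W.IsElliptic] [W.IsGloballyMinimal]

/-- ★ **KATO'S RANK BOUND AT THE SECOND FIXED POINT.** `W/ℚ` globally minimal, good ordinary at `2`, `f` a newform of `W` (any level) with
Kato 17.4 (1)(2) AT `2` (`h17`), `G ∈ Λ` an integral lift of `L₂(f,α)` with `ord_{T=−2} G = n`; `κ` the cyclotomic `ℤ₂`-extension with
normalised topological generator `γ`. Then **`rank_ℤ W(ℚ₁) ≤ rank_ℤ W(ℚ) + n`** at the first layer `ℚ₁` (`= ℚ(√2)`): otherwise Greenberg's count puts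
`ξ₂^{n+1} = (T+2)^{n+1}` into `f_X`, and `f_X · a = 2ᵐ · G` with `(T+2) ∤ 2ᵐ` gives `(T+2)^{n+1} ∣ G`.
[cite: Kato2004Asterisque, Thm. 17.4 (1)(2) (p. 273) and Thm. 18.4 (p. 281)] [cite: GreenbergLNM1716, Thm. 1.9 (p. 63) and §5 p. 132] -/
theorem mordellWeilRank_layer_one_le_add_orderAtNegTwo {N : ℕ} [NeZero N] {f : CuspForm (Gamma0 N) 2}
    (h17 : kato_divisibility_allPrimes W 2 (f := f)) (hord : IsOrdinaryAt W 2) (hf : IsNewformOf W f)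
    {G : IwasawaAlgebra 2} (hG : iwasawaToPowerSeries 2 G = padicLFunction f (unitRoot W 2 : ℚ_[2])) {n : ℕ}
    (hn : HasOrderAtNegTwo G n) {κ : ZpExtension ℚ 2} {γ : Field.absoluteGaloisGroup ℚ} (hκ : κ.IsCyclotomic)
    (hγ : κ.IsTopGenerator γ) (hγ' : IsCyclotomicVariable 2 γ) :
    (W.baseChange (κ.layer 1)).mordellWeilRank ≤ W.mordellWeilRank + n := by
  by_contra hlt
  have hle : W.mordellWeilRank + (2 - 1) * (n + 1) ≤ (W.baseChange (κ.layer 1)).mordellWeilRank := by omega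
  obtain ⟨D⟩ := W.nonempty_selmerDualData_holds κ γ hγ
  haveI : Module.Finite (IwasawaAlgebra 2) D.X := D.module_finite_holds hγ
  haveI : (Module.charIdeal (IwasawaAlgebra 2) D.X).IsPrincipal := charIdeal_isPrincipal_holds 2 D.X
  obtain ⟨fX, hfX⟩ := Submodule.IsPrincipal.principal (Module.charIdeal (IwasawaAlgebra 2) D.X)
  have hchar : D.charIdeal = Ideal.span {fX} := hfX
  obtain ⟨hD, a, m, hrel⟩ := isTorsion_and_exists_charGen_mul_eq_C_pow_mul_of_kato W h17 hκ hγ hγ' hord hf D hchar hG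
  have hdvd : xi 2 ^ (n + 1) ∣ fX := xi_pow_dvd_of_charIdeal_eq_span_of_rank_le W hγ D hD hchar hle
  rw [xi_two] at hdvd
  have h1 : (X + C (2 : ℤ_[2])) ^ (n + 1) ∣ C (((2 : ℕ) : ℤ_[2]) ^ m) * G := dvd_trans hdvd ⟨a, hrel.symm⟩
  have h2m : (((2 : ℕ) : ℤ_[2]) ^ m) ≠ 0 := pow_ne_zero _ (by exact_mod_cast (two_ne_zero : (2 : ℕ) ≠ 0))
  exact hn.2 (prime_X_add_C_two.pow_dvd_of_dvd_mul_left (n + 1) (not_X_add_C_two_dvd_C h2m) h1)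

/-- **The layer-one rank certificate is REFUTED above Kato's bound**: with the hypotheses of `mordellWeilRank_layer_one_le_add_orderAtNegTwo`,
`¬ Iwasawa.LayerRankGEAt W 2 1 m` for every `m > rank W(ℚ) + ord_{T=−2} G` (read at the normalised cyclotomic datum, which exists:
`exists_isCyclotomic_isTopGenerator_isCyclotomicVariable_holds`). [cite: Kato2004Asterisque, Thm. 17.4 (1)(2) (p. 273)] [cite: GreenbergLNM1716, §5 p. 132] -/
theorem not_layerRankGEAt_one {N : ℕ} [NeZero N] {f : CuspForm (Gamma0 N) 2}
    (h17 : kato_divisibility_allPrimes W 2 (f := f)) (hord : IsOrdinaryAt W 2) (hf : IsNewformOf W f)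
    {G : IwasawaAlgebra 2} (hG : iwasawaToPowerSeries 2 G = padicLFunction f (unitRoot W 2 : ℚ_[2])) {n : ℕ}
    (hn : HasOrderAtNegTwo G n) {m : ℕ} (hm : W.mordellWeilRank + n < m) : ¬ Iwasawa.LayerRankGEAt W 2 1 m := by
  intro h
  obtain ⟨κ, hκ, γ, hγ, hγ'⟩ := exists_isCyclotomic_isTopGenerator_isCyclotomicVariable_holds 2
  have h1 := h κ hκ
  have h2 := mordellWeilRank_layer_one_le_add_orderAtNegTwo W h17 hord hf hG hn hκ hγ hγ'
  omega

/-! ## §3 On the road: `rank W(ℚ(√2)) ≤ 1` (`a₂ = +1`), `≤ 3` (`a₂ = −1`); road-free `≤ 2·ord₂ #Ẽ(𝔽₂)` -/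

/-- `a₂ = +1`, good ordinary at `2`, `‖[0]⁺_f‖₂ = 1` (so `L(W,1) ≠ 0`), PRINT `h17` + `hGZK`: **`rank W(ℚ₁) ≤ 2`** at the first cyclotomic layer —
no road hypothesis, no `μ` (`ord₋₂ L₂ ≤ 2·ord₂ #Ẽ(𝔽₂) = 2`, g33 `orderAtNegTwo_le_two_of_frobeniusTrace_eq_one`; `rank W(ℚ) = 0` by GZK).
[cite: Kato2004Asterisque, Thm. 17.4 (1)(2) (p. 273)] [cite: MazurTateTeitelbaum1986Invent, §I.14 (14.3)] -/
theorem mordellWeilRank_layer_one_le_two_of_frobeniusTrace_eq_one [NeZero (W.conductorNorm ℤ)]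
    {f : CuspForm (Gamma0 (W.conductorNorm ℤ)) 2} (h17 : kato_divisibility_allPrimes W 2 (f := f))
    (hGZK : rank_eq_analyticRank_of_analyticRank_le_one) (hord : IsOrdinaryAt W 2) (hf : IsNewformOf W f)
    (ha : W.frobeniusTrace 2 = 1) (hr : W.analyticRank = 0)
    {G : IwasawaAlgebra 2} (hG : iwasawaToPowerSeries 2 G = padicLFunction f (unitRoot W 2 : ℚ_[2]))
    (hsym : ‖(ratPlusSymbol f 0 : ℚ_[2])‖ = 1) {κ : ZpExtension ℚ 2} {γ : Field.absoluteGaloisGroup ℚ} (hκ : κ.IsCyclotomic)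
    (hγ : κ.IsTopGenerator γ) (hγ' : IsCyclotomicVariable 2 γ) : (W.baseChange (κ.layer 1)).mordellWeilRank ≤ 2 := by
  have hG0 : G ≠ 0 := by
    intro h0
    rw [h0, map_zero] at hG
    exact padicLFunction_unitRoot_ne_zero hord hf hG.symm
  obtain ⟨n, hn⟩ := exists_hasOrderAtNegTwo hG0
  have hn2 : n ≤ 2 := orderAtNegTwo_le_two_of_frobeniusTrace_eq_one hord hf ha hG hsym hn.1
  have hrk : W.mordellWeilRank = 0 := by rw [(hGZK W (by rw [hr]; exact zero_le_one)).1, hr]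
  have h := mordellWeilRank_layer_one_le_add_orderAtNegTwo W h17 hord hf hG hn hκ hγ hγ'
  omega

/-- `a₂ = −1`, good ordinary at `2`, `‖[0]⁺_f‖₂ = 1`, PRINT `h17` + `hGZK`: **`rank W(ℚ₁) ≤ 4`** (road-free; `#Ẽ(𝔽₂) = 4`).
[cite: Kato2004Asterisque, Thm. 17.4 (1)(2) (p. 273)] [cite: MazurTateTeitelbaum1986Invent, §I.14 (14.3)] -/
theorem mordellWeilRank_layer_one_le_four_of_frobeniusTrace_eq_neg_one [NeZero (W.conductorNorm ℤ)]
    {f : CuspForm (Gamma0 (W.conductorNorm ℤ)) 2} (h17 : kato_divisibility_allPrimes W 2 (f := f))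
    (hGZK : rank_eq_analyticRank_of_analyticRank_le_one) (hord : IsOrdinaryAt W 2) (hf : IsNewformOf W f)
    (ha : W.frobeniusTrace 2 = -1) (hr : W.analyticRank = 0)
    {G : IwasawaAlgebra 2} (hG : iwasawaToPowerSeries 2 G = padicLFunction f (unitRoot W 2 : ℚ_[2]))
    (hsym : ‖(ratPlusSymbol f 0 : ℚ_[2])‖ = 1) {κ : ZpExtension ℚ 2} {γ : Field.absoluteGaloisGroup ℚ} (hκ : κ.IsCyclotomic)
    (hγ : κ.IsTopGenerator γ) (hγ' : IsCyclotomicVariable 2 γ) : (W.baseChange (κ.layer 1)).mordellWeilRank ≤ 4 := by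
  have hG0 : G ≠ 0 := by
    intro h0
    rw [h0, map_zero] at hG
    exact padicLFunction_unitRoot_ne_zero hord hf hG.symm
  obtain ⟨n, hn⟩ := exists_hasOrderAtNegTwo hG0
  have hn4 : n ≤ 4 := orderAtNegTwo_le_four_of_frobeniusTrace_eq_neg_one hord hf ha hG hsym hn.1
  have hrk : W.mordellWeilRank = 0 := by rw [(hGZK W (by rw [hr]; exact zero_le_one)).1, hr]
  have h := mordellWeilRank_layer_one_le_add_orderAtNegTwo W h17 hord hf hG hn hκ hγ hγ'
  omega

/-- ★ **ON THE `a₂ = +1` ROAD, `rank W(ℚ(√2)) ≤ 1`.** `W/ℚ` globally minimal, good ordinary at `2`, `a₂ = +1`, `∏ c_v` odd, `Δ_min ≡ 3, 5 (mod 8)`,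
`r_an = 0`, `f` its newform at level `N_W` with `‖[0]⁺_f‖₂ = 1`, `G` an integral lift of `L₂(f,α)`; PRINT `h17` + `hGZK`. The zero of `L₂` at the
order-`2` character is simple (g33, this seat), so Kato's bound at `T = −2` caps the Mordell–Weil growth in the first layer of the `2`-tower at ONE —
the rank that `w(W ⊗ χ₈) = −1` predicts for the twist (Greenberg's conductor-69 mechanism «`E(ℚ(√2))` has rank 1», p. 176, on a whole cell).
[cite: Kato2004Asterisque, Thm. 17.4 (1)(2) (p. 273)] [cite: GreenbergLNM1716, §5 p. 176 and p. 181] -/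
theorem mordellWeilRank_layer_one_le_one_of_road [NeZero (W.conductorNorm ℤ)]
    {f : CuspForm (Gamma0 (W.conductorNorm ℤ)) 2} (h17 : kato_divisibility_allPrimes W 2 (f := f))
    (hGZK : rank_eq_analyticRank_of_analyticRank_le_one) (hord : IsOrdinaryAt W 2) (hf : IsNewformOf W f)
    (ha : W.frobeniusTrace 2 = 1) (hodd : Odd W.tamagawaProduct)
    (hΔ : minimalDiscriminantInt W % 8 = 3 ∨ minimalDiscriminantInt W % 8 = 5) (hr : W.analyticRank = 0)
    {G : IwasawaAlgebra 2} (hG : iwasawaToPowerSeries 2 G = padicLFunction f (unitRoot W 2 : ℚ_[2]))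
    (hsym : ‖(ratPlusSymbol f 0 : ℚ_[2])‖ = 1) {κ : ZpExtension ℚ 2} {γ : Field.absoluteGaloisGroup ℚ} (hκ : κ.IsCyclotomic)
    (hγ : κ.IsTopGenerator γ) (hγ' : IsCyclotomicVariable 2 γ) : (W.baseChange (κ.layer 1)).mordellWeilRank ≤ 1 := by
  have hG0 : G ≠ 0 := by
    intro h0
    rw [h0, map_zero] at hG
    exact padicLFunction_unitRoot_ne_zero hord hf hG.symm
  obtain ⟨n, hn⟩ := exists_hasOrderAtNegTwo hG0
  have hn1 : n = 1 := orderAtNegTwo_eq_one_of_road_of_frobeniusTrace_eq_one hord hf ha hodd hΔ hr hG hsym hn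
  have hrk : W.mordellWeilRank = 0 := by rw [(hGZK W (by rw [hr]; exact zero_le_one)).1, hr]
  have h := mordellWeilRank_layer_one_le_add_orderAtNegTwo W h17 hord hf hG hn hκ hγ hγ'
  omega

/-- **On the `a₂ = −1` road, `rank W(ℚ(√2)) ≤ 3`** (`ord₋₂ L₂ ∈ {1, 3}`, g33). [cite: Kato2004Asterisque, Thm. 17.4 (1)(2) (p. 273)]
[cite: GreenbergLNM1716, §5 p. 181] -/
theorem mordellWeilRank_layer_one_le_three_of_road [NeZero (W.conductorNorm ℤ)]
    {f : CuspForm (Gamma0 (W.conductorNorm ℤ)) 2} (h17 : kato_divisibility_allPrimes W 2 (f := f))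
    (hGZK : rank_eq_analyticRank_of_analyticRank_le_one) (hord : IsOrdinaryAt W 2) (hf : IsNewformOf W f)
    (ha : W.frobeniusTrace 2 = -1) (hodd : Odd W.tamagawaProduct)
    (hΔ : minimalDiscriminantInt W % 8 = 3 ∨ minimalDiscriminantInt W % 8 = 5) (hr : W.analyticRank = 0)
    {G : IwasawaAlgebra 2} (hG : iwasawaToPowerSeries 2 G = padicLFunction f (unitRoot W 2 : ℚ_[2]))
    (hsym : ‖(ratPlusSymbol f 0 : ℚ_[2])‖ = 1) {κ : ZpExtension ℚ 2} {γ : Field.absoluteGaloisGroup ℚ} (hκ : κ.IsCyclotomic)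
    (hγ : κ.IsTopGenerator γ) (hγ' : IsCyclotomicVariable 2 γ) : (W.baseChange (κ.layer 1)).mordellWeilRank ≤ 3 := by
  have hG0 : G ≠ 0 := by
    intro h0
    rw [h0, map_zero] at hG
    exact padicLFunction_unitRoot_ne_zero hord hf hG.symm
  obtain ⟨n, hn⟩ := exists_hasOrderAtNegTwo hG0
  have hn3 : n = 1 ∨ n = 3 := orderAtNegTwo_eq_one_or_three_of_road_of_frobeniusTrace_eq_neg_one hord hf ha hodd hΔ hr hG hsym hn
  have hrk : W.mordellWeilRank = 0 := by rw [(hGZK W (by rw [hr]; exact zero_le_one)).1, hr]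
  have h := mordellWeilRank_layer_one_le_add_orderAtNegTwo W h17 hord hf hG hn hκ hγ hγ'
  omega

/-- **In the road's currency** (`hper` + «`L(W,1)/Ω_W = q`, `ord₂ q = 0`», no rational point of order `2`): on the `a₂ = +1` road
`rank W(ℚ(√2)) ≤ 1`. [cite: AbbesUllmo1996, Thm. A] [cite: Kato2004Asterisque, Thm. 17.4 (1)(2) (p. 273)] -/
theorem mordellWeilRank_layer_one_le_one_of_road_of_lValue [NeZero (W.conductorNorm ℤ)]
    {f : CuspForm (Gamma0 (W.conductorNorm ℤ)) 2} (h17 : kato_divisibility_allPrimes W 2 (f := f))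
    (hper : realPeriodRat_eq_unit_mul_plusPeriod_two) (hGZK : rank_eq_analyticRank_of_analyticRank_le_one)
    (hord : IsOrdinaryAt W 2) (ht : ∀ x : ℚ, ¬ HasRationalTwoTorsionX W x) (hf : IsNewformOf W f)
    (ha : W.frobeniusTrace 2 = 1) (hodd : Odd W.tamagawaProduct)
    (hΔ : minimalDiscriminantInt W % 8 = 3 ∨ minimalDiscriminantInt W % 8 = 5) (hr : W.analyticRank = 0)
    (hL : ∃ q : ℚ, q ≠ 0 ∧ W.entireLFunction 1 / (W.realPeriodRat : ℂ) = (q : ℂ) ∧ padicValRat 2 q = 0)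
    {G : IwasawaAlgebra 2} (hG : iwasawaToPowerSeries 2 G = padicLFunction f (unitRoot W 2 : ℚ_[2]))
    {κ : ZpExtension ℚ 2} {γ : Field.absoluteGaloisGroup ℚ} (hκ : κ.IsCyclotomic) (hγ : κ.IsTopGenerator γ)
    (hγ' : IsCyclotomicVariable 2 γ) : (W.baseChange (κ.layer 1)).mordellWeilRank ≤ 1 :=
  mordellWeilRank_layer_one_le_one_of_road W h17 hGZK hord hf ha hodd hΔ hr hG
    (norm_ratPlusSymbol_zero_eq_one_of_lValue hper hord.1
      (AlignedTransportAtTwoSeed.irr_two_of_forall_not_hasRationalTwoTorsionX W ht) hf hL) hκ hγ hγ'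

end Summit.BirchSwinnertonDyer.BirchSwinnertonDyer.Theorems.AlignedTransportAtTwoLayerOneRankBound

end
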